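import Literature.AlgebraicGeometry.Morphisms.IsoOfFibreIsoFlatProper
import Mathlib.AlgebraicGeometry.Morphisms.FlatDescent
import HarnessLib

/-!
# The iso-locus of a flat proper family: an open over which the morphism IS an isomorphism, stable and reflected under base change

Topic `Literature/AlgebraicGeometry/Morphisms`, namespace `Literature.AlgebraicGeometry.Morphisms`. THEOREMS only (no
definition, no instance, no notation, no named fact); universe-polymorphic `Scheme.{u}`; generic. Sequel of `Morphisms/IsoOfFibreIsoFlatProper`
(Görtz–Wedhorn I, Prop. 14.28).

THE PRINT. Görtz–Wedhorn I, Prop. 14.28 with Prop. 12.93 (constructible ∕ open loci) and Thm. 14.72 (fpqc descent): for `f : X → S` proper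
flat, `q : P → S` separated universally closed (`P` locally Noetherian), `g : X → P` over `S`, the set `U` of `s ∈ S` whose fibre morphism
`X_s → P_s` is an isomorphism is OPEN, `g` is an isomorphism over `q⁻¹(U)`, and for every `b : T → S` the base change `g ×_S T` is an
isomorphism iff `b(T) ⊆ U` («⇐» base change; «⇒» the fibres of `g ×_S T` are isomorphisms, and an isomorphism of `κ(s)`-schemes is
detected after the faithfully flat field extension `κ(s) → κ(t)`). This is the representability of the sub-functor «`g_T` is an
isomorphism» of `h_S` by the open subscheme `U` — the openness input for Hom-schemes ([MFK94] Prop. 6.16).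

WHAT IS HERE.
* **`exists_opens_isIso_morphismRestrict_forall_mem_iff`** — the iso-locus: an open `U ⊆ S` with `g ∣_ q⁻¹U` an isomorphism and `s ∈ U` iff
  the canonical fibre morphism (`pullback.map`) at `s` is an isomorphism (isomorphisms are Zariski-local on the target; over `U` each fibre
  morphism is a base change of an isomorphism).
* `isPullback_fst_pullbackMap` (`X ×_S T = X ×_P (P ×_S T)`), `isIso_pullbackMap_of_range_subset` («`b(T) ⊆ U` ⇒ `g ×_S T` iso»),
  `isIso_fiberMap_of_isIso_fiberMap_pullback` (the fibre of `g ×_S T` at `t` is the base change of the fibre of `g` at `b t` along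
  `Spec κ(t) → Spec κ(b t)` — Mathlib `isPullback_fiberToSpecResidueField_of_isPullback` — and isomorphisms descend along it, Mathlib
  `Morphisms/FlatDescent`), **`isIso_pullbackMap_iff_range_subset : IsIso (g ×_S T) ↔ Set.range b ⊆ U`**.

Consumer: cell `hodgecm-mathlib` FLOOR 0 ∕ P1, sub-line F-4, brick (B2)(ii) (Hom-schemes as open pieces of Hilbert schemes).
HC_CM is proved only modulo the 7 printed citations until rung 0 closes — nothing here bears on a summit statement.

## References
* [GortzWedhorn2020] U. Görtz, T. Wedhorn, *Algebraic Geometry I: Schemes*, 2nd ed. (2020), Prop. 4.20 (p. 104), Proposition 14.28 (p. 438),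
  Prop. 12.93, Thm. 14.72 (p. 453).
-/

noncomputable section

-- `TopCat.Presheaf` is not reducible (as in Mathlib's `AlgebraicGeometry/Modules` and ★ `Morphisms/FibreChartRing`).
set_option backward.isDefEq.respectTransparency false

open CategoryTheory CategoryTheory.Limits AlgebraicGeometry TopologicalSpace Opposite TensorProduct

universe u

namespace Literature.AlgebraicGeometry.Morphisms

/-! ## §1 The iso-locus is open, and `g` is an isomorphism over it -/

section Locus

variable {X P S : Scheme.{u}} (f : X ⟶ S) (q : P ⟶ S) (g : X ⟶ P)

/-- **The iso-locus of a flat proper family is an open over which the morphism IS an isomorphism.** Under the hypotheses of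
`exists_isIso_morphismRestrict_preimage_of_fiberHom` there is an open `U ⊆ S` with `g ∣_ q⁻¹(U)` an isomorphism and such that a point
`s` lies in `U` iff the fibre morphism `X_s → P_s` (the canonical `pullback.map`) is an isomorphism: `U` is the union of the neighbourhoods
of Prop. 14.28 (isomorphisms are Zariski-local on the target), and conversely over `U` every fibre morphism is a base change of an
isomorphism (`isIso_fiberHom_of_isIso_morphismRestrict`). This is the set-theoretic half of the representability of the sub-functor «`g_T`
is an isomorphism» (the scheme-theoretic half — `T → S` factors through `U` iff `g_T` is an isomorphism — follows by descent of
isomorphisms along `Spec κ(t) → Spec κ(s)`). [cite: GortzWedhorn2020, Proposition 14.28 (p. 438) and Prop. 12.93 (p. 364)] -/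
theorem exists_opens_isIso_morphismRestrict_forall_mem_iff (hg : g ≫ q = f) [IsProper f] [IsSeparated q] [UniversallyClosed q]
    [Flat f] [IsLocallyNoetherian P] :
    ∃ U : S.Opens, IsIso (g ∣_ q ⁻¹ᵁ U) ∧ ∀ s : S, s ∈ U ↔
      IsIso (pullback.map f (S.fromSpecResidueField s) q (S.fromSpecResidueField s) g (𝟙 _) (𝟙 S)
        (by rw [Category.comp_id, hg]) (by rw [Category.comp_id, Category.id_comp])) := by
  -- the canonical fibre morphisms and their compatibilities
  let gs : ∀ s : S, f.fiber s ⟶ q.fiber s := fun s =>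
    pullback.map f (S.fromSpecResidueField s) q (S.fromSpecResidueField s) g (𝟙 _) (𝟙 S)
      (by rw [Category.comp_id, hg]) (by rw [Category.comp_id, Category.id_comp])
  have h₁ : ∀ s, gs s ≫ q.fiberι s = f.fiberι s ≫ g := fun s => pullback.lift_fst _ _ _
  have h₂ : ∀ s, gs s ≫ q.fiberToSpecResidueField s = f.fiberToSpecResidueField s := fun s => by
    change pullback.map _ _ _ _ _ _ _ _ _ ≫ pullback.snd _ _ = pullback.snd _ _
    rw [pullback.lift_snd, Category.comp_id]
  -- for each `s` with `gs s` an isomorphism, the open of Prop. 14.28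
  have hU : ∀ s : {s : S // IsIso (gs s)}, ∃ U : S.Opens, s.1 ∈ U ∧ IsIso (g ∣_ q ⁻¹ᵁ U) := fun s =>
    haveI := s.2
    exists_isIso_morphismRestrict_preimage_of_fiberHom f q g hg s.1 (gs s.1) (h₁ s.1) (h₂ s.1)
  choose U hsU hUiso using hU
  refine ⟨⨆ s, U s, ?_, fun s => ⟨fun hs => ?_, fun hs => Opens.mem_iSup.mpr ⟨⟨s, hs⟩, hsU ⟨s, hs⟩⟩⟩⟩
  · -- isomorphisms are Zariski-local on the target: cover `q⁻¹(⨆ U s)` by the `q⁻¹(U s)`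
    set W : S.Opens := ⨆ s, U s with hW
    refine IsZariskiLocalAtTarget.of_iSup_eq_top (P := MorphismProperty.isomorphisms Scheme)
      (fun s => (q ⁻¹ᵁ W).ι ⁻¹ᵁ (q ⁻¹ᵁ U s)) ?_ fun s => ?_
    · rw [← top_le_iff]
      rintro p -
      have hp : q.base ((q ⁻¹ᵁ W).ι.base p) ∈ W := p.2
      obtain ⟨s, hs⟩ := Opens.mem_iSup.mp hp
      exact Opens.mem_iSup.mpr ⟨s, hs⟩
    · have e1 := morphismRestrictRestrict g (q ⁻¹ᵁ W) ((q ⁻¹ᵁ W).ι ⁻¹ᵁ (q ⁻¹ᵁ U s))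
      have hle : q ⁻¹ᵁ U s ≤ q ⁻¹ᵁ W := fun p hp => Opens.mem_iSup.mpr ⟨s, hp⟩
      have himg : (q ⁻¹ᵁ W).ι ''ᵁ ((q ⁻¹ᵁ W).ι ⁻¹ᵁ (q ⁻¹ᵁ U s)) = q ⁻¹ᵁ U s := by
        rw [Scheme.Hom.image_preimage_eq_opensRange_inf, Scheme.Opens.opensRange_ι, inf_eq_right.mpr hle]
      have key : ∀ W' : P.Opens, W' = q ⁻¹ᵁ U s → (MorphismProperty.isomorphisms Scheme) (g ∣_ W') := by
        rintro W' rfl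
        exact (MorphismProperty.isomorphisms.iff _).mpr (hUiso s)
      exact ((MorphismProperty.isomorphisms Scheme).arrow_mk_iso_iff e1).mpr (key _ himg)
  · -- over `U s'` the fibre morphism at `s` is a base change of an isomorphism
    obtain ⟨s', hs'⟩ := Opens.mem_iSup.mp hs
    haveI := hUiso s'
    exact isIso_fiberHom_of_isIso_morphismRestrict f q g hg s (gs s) (h₁ s) (h₂ s) (U s') hs'

end Locus

/-! ## §2 Base change: `g_T : X ×_S T → P ×_S T` is an isomorphism iff `T → S` lands in the iso-locus -/

section BaseChange

variable {X P S : Scheme.{u}} (f : X ⟶ S) (q : P ⟶ S) (g : X ⟶ P)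

/-- **`X ×_S T = X ×_P (P ×_S T)`**: for `g ≫ q = f` and `b : T → S`, the square `(pr_X, g_T; g, pr_P)` with
`g_T = g ×_S T : X ×_S T → P ×_S T` (Mathlib `pullback.map`) is cartesian. [cite: GortzWedhorn2020, Prop. 4.20 (p. 104)] -/
theorem isPullback_fst_pullbackMap (hg : g ≫ q = f) {T : Scheme.{u}} (b : T ⟶ S) :
    IsPullback (pullback.fst f b)
      (pullback.map f b q b g (𝟙 T) (𝟙 S) (by rw [Category.comp_id, hg]) (by rw [Category.comp_id, Category.id_comp]))
      g (pullback.fst q b) := by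
  refine IsPullback.of_bot (v₂₁ := pullback.snd q b) (v₂₂ := q) (h₃₁ := b) ?_ ?_ (IsPullback.of_hasPullback q b)
  · have e : pullback.map f b q b g (𝟙 T) (𝟙 S) (by rw [Category.comp_id, hg]) (by rw [Category.comp_id, Category.id_comp]) ≫
        pullback.snd q b = pullback.snd f b := by
      rw [pullback.lift_snd, Category.comp_id]
    rw [e, hg]
    exact IsPullback.of_hasPullback f b
  · exact (pullback.lift_fst _ _ _).symm

/-- **If `T → S` lands in an open `U` over which `g` is an isomorphism, then `g_T = g ×_S T` is an isomorphism**: `g_T` is the base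
change of `g ∣ q⁻¹(U)` along `P ×_S T → q⁻¹(U)`. [cite: GortzWedhorn2020, Prop. 4.20 (p. 104) and Proposition 14.28 (p. 438)] -/
theorem isIso_pullbackMap_of_range_subset (hg : g ≫ q = f) (U : S.Opens) [IsIso (g ∣_ q ⁻¹ᵁ U)] {T : Scheme.{u}}
    (b : T ⟶ S) (hb : Set.range b ⊆ (U : Set S)) :
    IsIso (pullback.map f b q b g (𝟙 T) (𝟙 S) (by rw [Category.comp_id, hg]) (by rw [Category.comp_id, Category.id_comp])) := by
  set gT := pullback.map f b q b g (𝟙 T) (𝟙 S) (by rw [Category.comp_id, hg]) (by rw [Category.comp_id, Category.id_comp])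
    with hgT
  -- the projections land in `q⁻¹(U)` and `g⁻¹(q⁻¹(U))`
  have hrP : Set.range (pullback.fst q b) ⊆ Set.range (q ⁻¹ᵁ U).ι := by
    rw [Scheme.Opens.range_ι]
    rintro _ ⟨z, rfl⟩
    change q (pullback.fst q b z) ∈ U
    rw [← Scheme.Hom.comp_apply, pullback.condition, Scheme.Hom.comp_apply]
    exact hb ⟨_, rfl⟩
  have hrX : Set.range (pullback.fst f b) ⊆ Set.range (g ⁻¹ᵁ q ⁻¹ᵁ U).ι := by
    rw [Scheme.Opens.range_ι]
    rintro _ ⟨z, rfl⟩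
    change q (g (pullback.fst f b z)) ∈ U
    rw [← Scheme.Hom.comp_apply, ← Scheme.Hom.comp_apply, hg, pullback.condition, Scheme.Hom.comp_apply]
    exact hb ⟨_, rfl⟩
  let ℓP := IsOpenImmersion.lift (q ⁻¹ᵁ U).ι (pullback.fst q b) hrP
  let ℓX := IsOpenImmersion.lift (g ⁻¹ᵁ q ⁻¹ᵁ U).ι (pullback.fst f b) hrX
  have hℓP : ℓP ≫ (q ⁻¹ᵁ U).ι = pullback.fst q b := IsOpenImmersion.lift_fac _ _ _
  have hℓX : ℓX ≫ (g ⁻¹ᵁ q ⁻¹ᵁ U).ι = pullback.fst f b := IsOpenImmersion.lift_fac _ _ _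
  -- `g_T` is the base change of `g ∣ q⁻¹U` along `ℓP`
  have hsq : IsPullback ℓX gT (g ∣_ q ⁻¹ᵁ U) ℓP := by
    refine IsPullback.of_right (h₁₂ := (g ⁻¹ᵁ q ⁻¹ᵁ U).ι) (v₁₃ := g) (h₂₂ := (q ⁻¹ᵁ U).ι) ?_ ?_
      (isPullback_morphismRestrict g (q ⁻¹ᵁ U)).flip
    · rw [hℓX, hℓP, hgT]
      exact isPullback_fst_pullbackMap f q g hg b
    · rw [← cancel_mono (q ⁻¹ᵁ U).ι, Category.assoc, Category.assoc, morphismRestrict_ι, ← Category.assoc, hℓX, hℓP, hgT]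
      exact (pullback.lift_fst _ _ _).symm
  exact hsq.isIso_snd_of_isIso

/-- **Descent of the fibre isomorphism along `κ(s) → κ(t)`.** For `g ≫ q = f`, `b : T → S` and `t ∈ T` with `s = b(t)`: the canonical fibre
morphism of `g_T = g ×_S T` at `t` is the base change of the canonical fibre morphism of `g` at `s` along the faithfully flat quasi-compact
`P_s ×_{κ(s)} κ(t) → P_s` (Mathlib `isPullback_fiberToSpecResidueField_of_isPullback`); so if the former is an isomorphism, so is the latter
(fpqc descent of isomorphisms, Mathlib `Morphisms/FlatDescent`). [cite: GortzWedhorn2020, Thm. 14.72 (p. 453) and Proposition 14.28 (p. 438)] -/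
theorem isIso_fiberMap_of_isIso_fiberMap_pullback (hg : g ≫ q = f) {T : Scheme.{u}} (b : T ⟶ S) (t : T)
    [IsIso (pullback.map (pullback.snd f b) (T.fromSpecResidueField t) (pullback.snd q b) (T.fromSpecResidueField t)
      (pullback.map f b q b g (𝟙 T) (𝟙 S) (by rw [Category.comp_id, hg]) (by rw [Category.comp_id, Category.id_comp]))
      (𝟙 _) (𝟙 T) (by rw [Category.comp_id, pullback.lift_snd, Category.comp_id]) (by rw [Category.comp_id, Category.id_comp]))] :
    IsIso (pullback.map f (S.fromSpecResidueField (b t)) q (S.fromSpecResidueField (b t)) g (𝟙 _) (𝟙 S)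
      (by rw [Category.comp_id, hg]) (by rw [Category.comp_id, Category.id_comp])) := by
  -- names
  set s := b t with hs
  set fT := pullback.snd f b with hfT
  set qT := pullback.snd q b with hqT
  set gT := pullback.map f b q b g (𝟙 T) (𝟙 S) (by rw [Category.comp_id, hg]) (by rw [Category.comp_id, Category.id_comp])
    with hgT
  have hgT' : gT ≫ qT = fT := by rw [hgT, hqT, pullback.lift_snd, Category.comp_id]
  set gs := pullback.map f (S.fromSpecResidueField s) q (S.fromSpecResidueField s) g (𝟙 _) (𝟙 S)
      (by rw [Category.comp_id, hg]) (by rw [Category.comp_id, Category.id_comp]) with hgs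
  set gsT := pullback.map fT (T.fromSpecResidueField t) qT (T.fromSpecResidueField t) gT (𝟙 _) (𝟙 T)
      (by rw [Category.comp_id, hgT']) (by rw [Category.comp_id, Category.id_comp]) with hgsT
  have h₁ : gs ≫ q.fiberι s = f.fiberι s ≫ g := pullback.lift_fst _ _ _
  have h₂ : gs ≫ q.fiberToSpecResidueField s = f.fiberToSpecResidueField s := by
    change pullback.map _ _ _ _ _ _ _ _ _ ≫ pullback.snd _ _ = pullback.snd _ _
    rw [pullback.lift_snd, Category.comp_id]
  have h₁T : gsT ≫ qT.fiberι t = fT.fiberι t ≫ gT := pullback.lift_fst _ _ _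
  have h₂T : gsT ≫ qT.fiberToSpecResidueField t = fT.fiberToSpecResidueField t := by
    change pullback.map _ _ _ _ _ _ _ _ _ ≫ pullback.snd _ _ = pullback.snd _ _
    rw [pullback.lift_snd, Category.comp_id]
  -- the fibres of the base changes are the base changes of the fibres along `Spec κ(t) → Spec κ(s)`
  have hφP := isPullback_fiberToSpecResidueField_of_isPullback (IsPullback.of_hasPullback q b) t
  have hφX := isPullback_fiberToSpecResidueField_of_isPullback (IsPullback.of_hasPullback f b) t
  set φP := pullback.map qT (T.fromSpecResidueField t) q (S.fromSpecResidueField (b t)) (pullback.fst q b)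
      (Spec.map (b.residueFieldMap t)) b (IsPullback.of_hasPullback q b).w.symm (by simp) with hφPdef
  set φX := pullback.map fT (T.fromSpecResidueField t) f (S.fromSpecResidueField (b t)) (pullback.fst f b)
      (Spec.map (b.residueFieldMap t)) b (IsPullback.of_hasPullback f b).w.symm (by simp) with hφXdef
  -- `φP` is surjective, flat and quasi-compact (a base change of `Spec κ(t) → Spec κ(s)`)
  have hr : (@Surjective ⊓ @Flat ⊓ @QuasiCompact : MorphismProperty Scheme.{u}) (Spec.map (b.residueFieldMap t)) := by
    refine ⟨⟨?_, ?_⟩, inferInstance⟩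
    · exact ⟨fun z => ⟨IsLocalRing.closedPoint _, Subsingleton.elim (α := PrimeSpectrum _) _ _⟩⟩
    · rw [Flat.SpecMap_iff]
      letI := (b.residueFieldMap t).hom.toAlgebra
      exact RingHom.flat_algebraMap_iff.mpr inferInstance
  have hQ : (@Surjective ⊓ @Flat ⊓ @QuasiCompact : MorphismProperty Scheme.{u}) φP :=
    ⟨⟨MorphismProperty.of_isPullback (P := @Surjective) hφP.flip hr.1.1,
      MorphismProperty.of_isPullback (P := @Flat) hφP.flip hr.1.2⟩,
      MorphismProperty.of_isPullback (P := @QuasiCompact) hφP.flip hr.2⟩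
  -- the cartesian square `(gsT, φX; φP, gs)`
  have hbig : IsPullback (φX ≫ f.fiberι s) gsT g (φP ≫ q.fiberι s) := by
    have eX : φX ≫ f.fiberι s = fT.fiberι t ≫ pullback.fst f b := pullback.lift_fst _ _ _
    have eP : φP ≫ q.fiberι s = qT.fiberι t ≫ pullback.fst q b := pullback.lift_fst _ _ _
    rw [eX, eP]
    have key := (isPullback_fiberHom_of_comp_eq fT qT gT hgT' t gsT h₁T h₂T).flip.paste_horiz
      (isPullback_fst_pullbackMap f q g hg b)
    exact key
  have hcomm : φX ≫ gs = gsT ≫ φP := by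
    apply pullback.hom_ext
    · rw [Category.assoc, Category.assoc]
      change φX ≫ gs ≫ q.fiberι s = gsT ≫ φP ≫ q.fiberι s
      rw [h₁, show φP ≫ q.fiberι s = qT.fiberι t ≫ pullback.fst q b from pullback.lift_fst _ _ _, ← Category.assoc,
        show φX ≫ f.fiberι s = fT.fiberι t ≫ pullback.fst f b from pullback.lift_fst _ _ _, ← Category.assoc, h₁T,
        Category.assoc, Category.assoc]
      congr 1
      exact (pullback.lift_fst _ _ _).symm
    · rw [Category.assoc, Category.assoc]
      change φX ≫ gs ≫ q.fiberToSpecResidueField s = gsT ≫ φP ≫ q.fiberToSpecResidueField s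
      rw [h₂, hφX.w, hφP.w, ← Category.assoc, h₂T]
  have hsq : IsPullback gsT φX φP gs :=
    (IsPullback.of_right hbig hcomm (isPullback_fiberHom_of_comp_eq f q g hg s gs h₁ h₂).flip).flip
  -- descend
  have hiso : (MorphismProperty.isomorphisms Scheme.{u}) gsT := (MorphismProperty.isomorphisms.iff _).mpr inferInstance
  exact (MorphismProperty.isomorphisms.iff _).mp
    (MorphismProperty.of_isPullback_of_descendsAlong (P := MorphismProperty.isomorphisms Scheme.{u})
      (Q := @Surjective ⊓ @Flat ⊓ @QuasiCompact) hsq hQ hiso)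

/-- **The iso-locus is an open sub-functor: `g_T = g ×_S T` is an isomorphism iff `T → S` lands in the iso-locus `U`.** Here `U ⊆ S` is any
open with `g ∣ q⁻¹(U)` an isomorphism and `s ∈ U ↔` (the fibre morphism at `s` is an isomorphism) — e.g. the open of
`exists_opens_isIso_morphismRestrict_forall_mem_iff`. «←»: base change (`isIso_pullbackMap_of_range_subset`); «→»: the fibres of `g_T` are
isomorphisms and descend to the fibres of `g` (`isIso_fiberMap_of_isIso_fiberMap_pullback`). With `T` affine this is the statement that the
sub-functor «`g_T` is an isomorphism» of `h_S` is represented by the open subscheme `U` — the openness input for Hom-schemes.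
[cite: GortzWedhorn2020, Proposition 14.28 (p. 438) and Thm. 14.72 (p. 453)] -/
theorem isIso_pullbackMap_iff_range_subset (hg : g ≫ q = f) (U : S.Opens) (hU : IsIso (g ∣_ q ⁻¹ᵁ U))
    (hUiff : ∀ s : S, s ∈ U ↔ IsIso (pullback.map f (S.fromSpecResidueField s) q (S.fromSpecResidueField s) g (𝟙 _) (𝟙 S)
        (by rw [Category.comp_id, hg]) (by rw [Category.comp_id, Category.id_comp])))
    {T : Scheme.{u}} (b : T ⟶ S) :
    IsIso (pullback.map f b q b g (𝟙 T) (𝟙 S) (by rw [Category.comp_id, hg]) (by rw [Category.comp_id, Category.id_comp])) ↔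
      Set.range b ⊆ (U : Set S) := by
  refine ⟨fun hiso => ?_, fun hb => haveI := hU; isIso_pullbackMap_of_range_subset f q g hg U b hb⟩
  rintro _ ⟨t, rfl⟩
  -- the fibre morphism of `g_T` at `t` is an isomorphism (a base change of `g_T ∣ ⊤ = g_T`)
  set fT := pullback.snd f b with hfT
  set qT := pullback.snd q b with hqT
  set gT := pullback.map f b q b g (𝟙 T) (𝟙 S) (by rw [Category.comp_id, hg]) (by rw [Category.comp_id, Category.id_comp])
    with hgT
  have hgT' : gT ≫ qT = fT := by rw [hgT, hqT, pullback.lift_snd, Category.comp_id]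
  set gsT := pullback.map fT (T.fromSpecResidueField t) qT (T.fromSpecResidueField t) gT (𝟙 _) (𝟙 T)
      (by rw [Category.comp_id, hgT']) (by rw [Category.comp_id, Category.id_comp]) with hgsT
  have h₁T : gsT ≫ qT.fiberι t = fT.fiberι t ≫ gT := pullback.lift_fst _ _ _
  have h₂T : gsT ≫ qT.fiberToSpecResidueField t = fT.fiberToSpecResidueField t := by
    change pullback.map _ _ _ _ _ _ _ _ _ ≫ pullback.snd _ _ = pullback.snd _ _
    rw [pullback.lift_snd, Category.comp_id]
  haveI : IsIso (gT ∣_ qT ⁻¹ᵁ ⊤) :=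
    (MorphismProperty.isomorphisms.iff _).mp
      (IsZariskiLocalAtTarget.restrict (P := MorphismProperty.isomorphisms Scheme.{u})
        ((MorphismProperty.isomorphisms.iff _).mpr hiso) ⊤)
  have hfib : IsIso gsT := isIso_fiberHom_of_isIso_morphismRestrict fT qT gT hgT' t gsT h₁T h₂T ⊤ trivial
  exact (hUiff (b t)).mpr (@isIso_fiberMap_of_isIso_fiberMap_pullback _ _ _ f q g hg _ b t hfib)

end BaseChange

end Literature.AlgebraicGeometry.Morphisms

end
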